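import Mathlib
import HarnessLib

/-!
# Stub `stub_convexWindow` (K3) for the crux `WeakCouplingHypercubicLimit` (line `Sketch`)

**Discrete maximum principle for step-one log-convex non-negative sequences.**  If `D : ℕ → ℝ` is
non-negative on the lag window `[lo, hi]`, log-convex with step one in its interior
(`D(m)² ≤ D(m−1)·D(m+1)` for `lo < m < hi`), and both end values are `≤ ε`, then `D ≤ ε` on the
whole window.  Proof: take the *smallest* maximiser `k` of `D` on `Finset.Icc lo hi`
(`Finset.exists_max_image` + `Nat.find`); if `k` is an endpoint we are done; if `k` is interior then
`D(k−1) < D(k) =: M`, `D(k+1) ≤ M`, so `M² ≤ D(k−1)·D(k+1) ≤ D(k−1)·M < M²` unless `M = 0`, and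
`M = 0` gives `D ≤ 0 ≤ D(lo) ≤ ε`.  Pure real analysis, Mathlib only. [folklore]
-/

namespace Summit.QuantumFields.YangMills.Theorems.WeakCouplingHypercubicLimit.TraceNormColdPressure

/-- `stub_convexWindow` (K3) — **discrete maximum principle**: a sequence that is non-negative on
`[lo, hi]` and log-convex with step one in its interior (`D(m)² ≤ D(m−1)·D(m+1)`) is bounded on
`[lo, hi]` by any common bound `ε` of its two end values (no strict interior maximum: the smallest
maximiser is an endpoint unless the maximum is `0`).  Pure real analysis. [folklore] -/
theorem stub_convexWindow :
    ∀ (D : ℕ → ℝ) (lo hi : ℕ) (ε : ℝ), lo ≤ hi →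
      (∀ m, lo ≤ m → m ≤ hi → 0 ≤ D m) →
      (∀ m, lo + 1 ≤ m → m + 1 ≤ hi → D m ^ 2 ≤ D (m - 1) * D (m + 1)) →
      D lo ≤ ε → D hi ≤ ε → ∀ m, lo ≤ m → m ≤ hi → D m ≤ ε := by
  intro D lo hi ε hlohi hnn hconv hlo hhi
  classical
  -- a maximiser of `D` on the window exists
  have hne : (Finset.Icc lo hi).Nonempty := ⟨lo, Finset.mem_Icc.mpr ⟨le_rfl, hlohi⟩⟩
  obtain ⟨m₀, hm₀, hmax₀⟩ := Finset.exists_max_image (Finset.Icc lo hi) D hne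
  -- `P k`: `k` is a maximiser of `D` on the window; take the smallest one
  have hP : ∃ k, lo ≤ k ∧ k ≤ hi ∧ ∀ m, lo ≤ m → m ≤ hi → D m ≤ D k :=
    ⟨m₀, (Finset.mem_Icc.mp hm₀).1, (Finset.mem_Icc.mp hm₀).2,
      fun m h1 h2 => hmax₀ m (Finset.mem_Icc.mpr ⟨h1, h2⟩)⟩
  obtain ⟨hk1, hk2, hkmax⟩ := Nat.find_spec hP
  have hmin : ∀ j, j < Nat.find hP → ¬ (lo ≤ j ∧ j ≤ hi ∧ ∀ m, lo ≤ m → m ≤ hi → D m ≤ D j) :=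
    fun j hj => Nat.find_min hP hj
  -- it suffices to bound the maximum
  suffices hDk : D (Nat.find hP) ≤ ε by
    intro m h1 h2
    exact le_trans (hkmax m h1 h2) hDk
  by_cases hklo : Nat.find hP = lo
  · rw [hklo]; exact hlo
  by_cases hkhi : Nat.find hP = hi
  · rw [hkhi]; exact hhi
  -- interior smallest maximiser: impossible unless the maximum vanishes
  have h1 : lo + 1 ≤ Nat.find hP := by omega
  have h2 : Nat.find hP + 1 ≤ hi := by omega
  have hc := hconv (Nat.find hP) h1 h2
  have hlt : D (Nat.find hP - 1) < D (Nat.find hP) := by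
    refine not_le.mp fun hge => ?_
    exact hmin (Nat.find hP - 1) (by omega)
      ⟨by omega, by omega, fun m hm1 hm2 => le_trans (hkmax m hm1 hm2) hge⟩
  have hle : D (Nat.find hP + 1) ≤ D (Nat.find hP) := hkmax (Nat.find hP + 1) (by omega) h2
  have hnn1 : 0 ≤ D (Nat.find hP - 1) := hnn (Nat.find hP - 1) (by omega) (by omega)
  have hnnk : 0 ≤ D (Nat.find hP) := hnn (Nat.find hP) hk1 hk2
  have hε : 0 ≤ ε := le_trans (hnn lo le_rfl hlohi) hlo
  rcases lt_or_eq_of_le hnnk with hpos | hzero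
  · exfalso
    have hsq : D (Nat.find hP) ^ 2 ≤ D (Nat.find hP - 1) * D (Nat.find hP) :=
      le_trans hc (mul_le_mul_of_nonneg_left hle hnn1)
    nlinarith
  · rw [← hzero]; exact hε

end Summit.QuantumFields.YangMills.Theorems.WeakCouplingHypercubicLimit.TraceNormColdPressure
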